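import Mathlib
import HarnessLib
import Summits.PneNP.PneNP.Theorems.CnfIdealGenLengthRankDefectRepresentationsCutLemma
import Summits.PneNP.PneNP.Theorems.CnfIdealGenLengthRankDefectRepresentationsCutLemmaExtension

/-!
# The one-step extension form of rank-stability holds (crux `RankDefectRepresentations` = stmt-PneNP-18923, line `rank-dehn-ladder`)

UNCONDITIONAL consequence of the cut lemma (`…RankDefectRepresentationsCutLemma.stub_cutLemma`, lead g7, p642852) through the
equivalence N1 ⟺ EXT of lead g6 (`…CutLemmaExtension.ext_of_cutLemma`, p620038):

  `extensionStep` — over a field of characteristic `0`, if `E_1, …, E_n` are commuting idempotents written in a common eigenbasis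
  (a colouring `c : Fin d → {0,1}^n` of the basis) and `X` is an idempotent each of whose coordinate cuts `X ∘ 1[c(x)_j ≠ c(y)_j]`
  (`= ±[E_j, X]`) has rank `≤ t`, then there is an IDEMPOTENT `X'` commuting with every `E_j` (supported on equal-colour pairs)
  with `rank (X − X') ≤ C · (n+1)^a · t` (the proofs give `C = 220`, `a = 1`).

In words: a commuting `n`-tuple of idempotents EXTENDS by one more almost-commuting idempotent at cost linear in `n` and in the
commutator rank — the last step of any generator-by-generator proof of `stub_uniformStability` (N0b).  What is NOT here: the
compounding over `n` generators (N0b itself), which stays open.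
HONEST FRAMING: negative-lane result for the crux; P ≠ NP is not moved; F-N2 is a FRONTIER formal rung.
-/

set_option linter.dupNamespace false -- `Summit.PneNP.PneNP.…`: summit = sub-problem name (D-0017)

namespace Summit.PneNP.PneNP.Theorems.CnfIdealGenLengthRankDefectRepresentationsExtensionStep

/-- **One-step extension (EXT), unconditional.**  See the module docstring. [folklore] -/
theorem extensionStep :
    ∃ C a : ℕ, ∀ (K : Type) [Field K] [CharZero K] (n d : ℕ) (c : Fin d → Fin n → Bool) (t : ℕ)
      (X : Matrix (Fin d) (Fin d) K), X * X = X →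
      (∀ j : Fin n, (Matrix.of fun x y => if c x j ≠ c y j then X x y else 0).rank ≤ t) →
        ∃ X' : Matrix (Fin d) (Fin d) K, X' * X' = X' ∧ (∀ x y, c x ≠ c y → X' x y = 0) ∧
          (X - X').rank ≤ C * (n + 1) ^ a * t := by
  obtain ⟨C, a, hC⟩ :=
    Summit.PneNP.PneNP.Theorems.CnfIdealGenLengthRankDefectRepresentationsCutLemmaExtension.ext_of_cutLemma
      (by
        obtain ⟨C, a, h⟩ := Summit.PneNP.PneNP.Theorems.CnfIdealGenLengthRankDefectRepresentationsCutLemma.stub_cutLemma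
        exact ⟨C, a, fun K _ _ n ι ι' _ _ row col t R hR => h K n ι ι' row col t R hR⟩)
  exact ⟨55 * C, a, fun K _ _ n d c t X hX hcut => hC K n d c t X hX hcut⟩

end Summit.PneNP.PneNP.Theorems.CnfIdealGenLengthRankDefectRepresentationsExtensionStep
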